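/-
Copyright (c) 2026 the pub-hodgecm-mathlib formalisation cell (harness21).  Prover seat hodgecm-mathlib-F0P3a-p07 (g13), 2026-09-02.  Road «S3-ram» seeding wave (LEAD T11-41∕T11-60; owner F0P3a-p06 (g15));
(α₂) organ A₂ (d-ax-1) «AXIS LEVEL LAW» for the type-(2) G-side (architect A-p12 (g23); design memo `DESIGN-A2d-TypeTwoGSide` v1.2: type (2) = isoceles with an elliptic axis).
-/
import Literature.NumberTheory.Automorphic.UnitaryLatticeTreeBlockTubeCriterion   -- ★ p847270∕p847280 (this seat): block bookkeeping `mulVec_eq_sub_smul_proj_add_smul`, `mulVec_single_of_col_eq`, `mulVec_apply_eq_zero_of_row_eq`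
import HarnessLib

/-!
# The lattice graph of a hermitian space — the LEVEL of a block endomorphism `S = S_W ⊕ u` at a SPLIT lattice `M = (M ∩ W) ⊕ 𝒪e_i` is `min(level of S_W at M ∩ W, ord(u − 1))`
# (Kottwitz 1986 §3; Bruhat–Tits 1972 §10)

Topic `NumberTheory/Automorphic`; namespace `Literature.NumberTheory.Automorphic.UnitaryLatticeTree`.  THEOREMS ONLY (no definition, no instance, no notation, no named fact,
no `sorry`); kernel lane `--supports stmt-HodgeConjecture-24833`; datum-free (`K` with `Valued K ℤᵐ⁰`).  Cell `pub/hodgecm-mathlib`, crux H413 = `stmt-HodgeConjecture-24833`;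
road «S3-ram» (count-neutral), (α₂) P-2-ram (architect A-p12 (g23)) organ A₂ (d) «type-(2) G-side counts», part **(d-ax-1) AXIS LEVEL LAW** (memo v1.2: the type-(2) fixed set
is «axis (the split vertices `B ⊕ 𝒪e` over the `γ_W`-fixed ball) + generic off-axis propagation», exactly the isoceles configuration of the type-(1) road with an elliptic axis).
Seat F0P3a-p07 (g13).  HONEST LABEL: HC_CM is proved only modulo the cell's 2 remaining named inputs (hLiu418 24832, h413 24833) until rung 0 closes; nothing printed is asserted
here (elementary lattice algebra over a valuation ring).

THE MATHEMATICS.  `S` block at `i` (column `i` = `u·e_i`, row `i` zero off the diagonal, `u = S_{ii}`), `M ⊆ K³` a SPLIT `𝒪`-submodule at `i`: `e_i ∈ M`, `|x_i| ≤ 1` on `M`, and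
`pr(x) = x − x_i e_i ∈ M` for `x ∈ M` (i.e. `M = (M ∩ W_i) ⊕ 𝒪e_i` — the axis vertices of memo v1.2, ★ p847252 at the top level).  For a level `c ≠ 0`:
  **`(S − 1)·M ⊆ c·M  ⟺  (S − 1)·(M ∩ W_i) ⊆ c·(M ∩ W_i)  ∧  |u − 1| ≤ |c|`**
— the depth of `γ = γ_W ⊕ u` at a split vertex is `min(depth of γ_W at the binary part, ord(u − 1))`.  With ★ p847270 (TC) this is the whole LOCAL structure of `γ` at the axis;
the residual datum (rank∕class of `c⁻¹(S − 1)` on `M∕πM`) splits the same way (organ (d-ax-2), matrix level).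
* `sub_mem_smul_of_split_iff` (the law), with its two halves `sub_mem_smul_inf_of_sub_mem_smul` ∕ `v_sub_one_le_of_sub_mem_smul` (⇒) and `sub_mem_smul_of_split` (⇐).

## References
* [Kottwitz1986] R. E. Kottwitz, *Base change for unit elements of Hecke algebras*, Compositio Math. 60 (1986), §3.
* [BruhatTits1972] F. Bruhat, J. Tits, *Groupes réductifs sur un corps local I*, Publ. Math. IHÉS 41 (1972), §10.
-/

set_option autoImplicit false

noncomputable section

open scoped Valued WithZero Matrix MatrixGroups

namespace Literature.NumberTheory.Automorphic.UnitaryLatticeTree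

open Literature.NumberTheory.Automorphic Literature.NumberTheory.Automorphic.HermitianLattice

variable {K : Type*} [Field K] [Valued K ℤᵐ⁰]

/-- **(⇒, W-part)**: if `(S − 1)M ⊆ c·M` (`S` block at `i`, row `i` zero off the diagonal, `c ≠ 0`) then `(S − 1)(M ∩ W_i) ⊆ c·(M ∩ W_i)`.
[cite: Kottwitz1986, §3] [cite: BruhatTits1972, §10] -/
theorem sub_mem_smul_inf_of_sub_mem_smul {S : Matrix (Fin 3) (Fin 3) K} (i : Fin 3) (hrow : ∀ l, l ≠ i → S i l = 0) {c : K} (hc : c ≠ 0)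
    {M : Submodule 𝒪[K] (Fin 3 → K)} (hSM : ∀ x ∈ M, ∃ y ∈ M, S *ᵥ x - x = c • y)
    {w : Fin 3 → K} (hw : w ∈ M) (hwi : w i = 0) :
    ∃ y ∈ M, y i = 0 ∧ S *ᵥ w - w = c • y := by
  obtain ⟨y, hy, hyw⟩ := hSM w hw
  refine ⟨y, hy, ?_, hyw⟩
  have h := congrFun hyw i
  rw [Pi.sub_apply, mulVec_apply_eq_zero_of_row_eq S i hrow hwi, hwi, sub_zero, Pi.smul_apply, smul_eq_mul] at h
  exact (mul_eq_zero.1 h.symm).resolve_left hc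

/-- **(⇒, line part)**: if `(S − 1)M ⊆ c·M` (`S` with `i`-th column `u·e_i`, `c ≠ 0`), `e_i ∈ M` and `|x_i| ≤ 1` on `M`, then `|u − 1| ≤ |c|`.
[cite: Kottwitz1986, §3] [cite: BruhatTits1972, §10] -/
theorem v_sub_one_le_of_sub_mem_smul {S : Matrix (Fin 3) (Fin 3) K} (i : Fin 3) (hcol : ∀ l, l ≠ i → S l i = 0) {c : K}
    {M : Submodule 𝒪[K] (Fin 3 → K)} (hSM : ∀ x ∈ M, ∃ y ∈ M, S *ᵥ x - x = c • y)
    (hei : (Pi.single i (1 : K) : Fin 3 → K) ∈ M) (hint : ∀ x ∈ M, Valued.v (x i) ≤ 1) :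
    Valued.v (S i i - 1) ≤ Valued.v c := by
  obtain ⟨y, hy, hye⟩ := hSM _ hei
  have h := congrFun hye i
  rw [Pi.sub_apply, mulVec_single_of_col_eq S i hcol, Pi.single_eq_same, Pi.single_eq_same, mul_one, Pi.smul_apply, smul_eq_mul] at h
  have hyi := hint y hy
  calc Valued.v (S i i - 1) = Valued.v c * Valued.v (y i) := by rw [h, map_mul]
    _ ≤ Valued.v c * 1 := mul_le_mul' le_rfl hyi
    _ = Valued.v c := mul_one _

/-- **(⇐)**: on a SPLIT `M` (`pr(x) ∈ M` and `|x_i| ≤ 1` for `x ∈ M`), `(S − 1)(M ∩ W_i) ⊆ c·(M ∩ W_i)` together with `|u − 1| ≤ |c|` give `(S − 1)M ⊆ c·M`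
(`S` with `i`-th column `u e_i`, `c ≠ 0`, `e_i ∈ M`). [cite: Kottwitz1986, §3] [cite: BruhatTits1972, §10] -/
theorem sub_mem_smul_of_split {S : Matrix (Fin 3) (Fin 3) K} (i : Fin 3) (hcol : ∀ l, l ≠ i → S l i = 0) {c : K} (hc : c ≠ 0)
    {M : Submodule 𝒪[K] (Fin 3 → K)} (hei : (Pi.single i (1 : K) : Fin 3 → K) ∈ M) (hint : ∀ x ∈ M, Valued.v (x i) ≤ 1)
    (hpr : ∀ x ∈ M, x - Pi.single i (x i) ∈ M)
    (hW : ∀ w ∈ M, w i = 0 → ∃ y ∈ M, S *ᵥ w - w = c • y) (hu : Valued.v (S i i - 1) ≤ Valued.v c)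
    {x : Fin 3 → K} (hx : x ∈ M) : ∃ y ∈ M, S *ᵥ x - x = c • y := by
  have hwi : (x - Pi.single i (x i) : Fin 3 → K) i = 0 := by simp
  obtain ⟨y, hy, hyw⟩ := hW _ (hpr x hx) hwi
  -- the line part: `x_i (u − 1) e_i = c · (x_i (u−1)∕c) e_i` with an integral coefficient
  have hcoef : Valued.v (x i * ((S i i - 1) / c)) ≤ 1 := by
    rw [map_mul, map_div₀]
    have hvc : Valued.v c ≠ 0 := fun h => hc ((map_eq_zero _).1 h)
    exact mul_le_one' (hint x hx) (div_le_one_of_le₀ hu zero_le)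
  refine ⟨y + (⟨x i * ((S i i - 1) / c), (mem_integer_iff' _).2 hcoef⟩ : 𝒪[K]) • (Pi.single i (1 : K) : Fin 3 → K),
    M.add_mem hy (M.smul_mem _ hei), ?_⟩
  -- `S x − x = (S·pr x − pr x) + x_i (u − 1) e_i`
  have hx' : x = (x - Pi.single i (x i)) + Pi.single i (x i) := (sub_add_cancel _ _).symm
  have hS : S *ᵥ x - x = (S *ᵥ (x - Pi.single i (x i)) - (x - Pi.single i (x i))) + Pi.single i ((S i i - 1) * x i) := by
    conv_lhs => rw [hx']
    rw [Matrix.mulVec_add, mulVec_single_of_col_eq S i hcol, sub_mul, one_mul, Pi.single_sub]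
    abel
  rw [hS, hyw, smul_add]
  congr 1
  change Pi.single i ((S i i - 1) * x i) = c • ((x i * ((S i i - 1) / c)) • (Pi.single i (1 : K) : Fin 3 → K))
  rw [← Pi.single_smul', ← Pi.single_smul', smul_eq_mul, smul_eq_mul, mul_one]
  congr 1
  field_simp

/-- **AXIS LEVEL LAW**: for `S` block at `i` (`i`-th column `u·e_i`, `i`-th row zero off the diagonal), a SPLIT `M` (`e_i ∈ M`, `|x_i| ≤ 1` and `pr(x) ∈ M` on `M`) and a level
`c ≠ 0`: `(S − 1)M ⊆ c·M ⟺ (S − 1)(M ∩ W_i) ⊆ c·(M ∩ W_i) ∧ |u − 1| ≤ |c|` — the depth of `γ_W ⊕ u` at an axis vertex `B ⊕ 𝒪e` is `min(depth of γ_W at B, ord(u − 1))`.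
[cite: Kottwitz1986, §3] [cite: BruhatTits1972, §10] -/
theorem sub_mem_smul_of_split_iff {S : Matrix (Fin 3) (Fin 3) K} (i : Fin 3) (hcol : ∀ l, l ≠ i → S l i = 0) (hrow : ∀ l, l ≠ i → S i l = 0) {c : K} (hc : c ≠ 0)
    {M : Submodule 𝒪[K] (Fin 3 → K)} (hei : (Pi.single i (1 : K) : Fin 3 → K) ∈ M) (hint : ∀ x ∈ M, Valued.v (x i) ≤ 1)
    (hpr : ∀ x ∈ M, x - Pi.single i (x i) ∈ M) :
    (∀ x ∈ M, ∃ y ∈ M, S *ᵥ x - x = c • y) ↔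
      (∀ w ∈ M, w i = 0 → ∃ y ∈ M, y i = 0 ∧ S *ᵥ w - w = c • y) ∧ Valued.v (S i i - 1) ≤ Valued.v c := by
  constructor
  · intro hSM
    exact ⟨fun w hw hwi => sub_mem_smul_inf_of_sub_mem_smul i hrow hc hSM hw hwi, v_sub_one_le_of_sub_mem_smul i hcol hSM hei hint⟩
  · rintro ⟨hW, hu⟩ x hx
    exact sub_mem_smul_of_split i hcol hc hei hint hpr (fun w hw hwi => by
      obtain ⟨y, hy, -, hyw⟩ := hW w hw hwi; exact ⟨y, hy, hyw⟩) hu hx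

end Literature.NumberTheory.Automorphic.UnitaryLatticeTree

end
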